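import Mathlib

/-!
# PrimalBracket — a CERTIFIED UPPER bracket on a moment relaxation's optimal value via the
universal β = 0 anchor (crux idea `primal-bracket-beta0-anchor` on
`Summit.Ventures.CertifiedManyBodySolver.Theses.M3PrimeEdgeSplit.LowerEdge_ge_m4o5`; first-lemma sketch).

Setting (the fleet's LMI / "y-form" programs, cf. `Literature.Computation.Certificates.JanssonChaykinKeil.lmiForm_bound`):
`v*(P) = inf { c·y : row_r·y = rhs_r, M_k(y) := C_k + Σ_v y_v F_{k,v} ⪰ 0 }`.  A first-order solver hands
back an ALMOST feasible primal iterate `x̂` (rows exact after presolve restoration, blocks `M_k(x̂) ⪰ −δ_k`).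
The β = 0 grand-canonical product state at the program's filling is an EXACTLY feasible anchor `y∞`
(rational coordinates `0, ±(7/16)^j`; Gram blocks positive definite, `M_k(y∞) ⪰ m_k·1`, `m_k > 0`; every
H-stationarity row holds because the state commutes with every number-conserving `H` — lemma L1).  Mixing,
`y_θ := (1−θ) x̂ + θ y∞` is feasible as soon as `θ ≥ max_k δ_k/(δ_k+m_k)` (lemma L2, blockwise), whence the
certified bracket `v*(P) ≤ c·y_θ = (1−θ) c·x̂ + θ c·y∞` (lemma L3 = JCK Thm 4.1 in y-form).
Nothing here is a lower bound; it is the missing UPPER handle of the cell's DEPTH RULE, made rigorous.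
-/

namespace Summit.Ventures.CertifiedManyBodySolver.Cruxes.LowerEdge_ge_m4o5.PrimalBracket

open Matrix

/-- **L1 (stationarity of charge-commuting states).** If `ρ` commutes with `H` then every commutator has
zero expectation, `Tr(ρ (H w − w H)) = 0`.  Applied box by box with `ρ_Λ ∝ z^{N_Λ}` (β = 0 product state)
and `H_Λ` the number-conserving part of `H` meeting `supp w`: the anchor satisfies EVERY eom row of EVERY
l1sym program, for all `(t, t′, U)` at the given filling. -/
theorem trace_mul_commutator_eq_zero {n : Type*} [Fintype n] [DecidableEq n]
    (ρ H w : Matrix n n ℂ) (hc : ρ * H = H * ρ) :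
    trace (ρ * (H * w - w * H)) = 0 := by
  rw [Matrix.mul_sub, Matrix.trace_sub, sub_eq_zero]
  calc trace (ρ * (H * w)) = trace (ρ * H * w) := by rw [Matrix.mul_assoc]
    _ = trace (H * ρ * w) := by rw [hc]
    _ = trace (H * (ρ * w)) := by rw [Matrix.mul_assoc]
    _ = trace (ρ * w * H) := (Matrix.trace_mul_comm _ _).symm
    _ = trace (ρ * (w * H)) := by rw [Matrix.mul_assoc]

/-- **L2 (anchor mixing restores positivity, with the explicit θ).** If `A ⪰ −δ·1` (an FO iterate's block,
`δ ≥ 0` its certified negative-eigenvalue floor) and `B ⪰ m·1` with `m > 0` (the anchor's block margin), then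
`(1−θ)A + θB ⪰ 0` for every `θ ∈ [δ/(δ+m), 1]`.  (y-form twin of the tree's
`Literature.Computation.Certificates.isPrimalFeasible_convexComb_of_slater`, Luo–Sturm Lemma 7.3.2.) -/
theorem anchorMix_posSemidef {n : Type*} [Fintype n] [DecidableEq n]
    {A B : Matrix n n ℝ} {δ m θ : ℝ} (hδ : 0 ≤ δ) (hm : 0 < m)
    (hA : (A + δ • (1 : Matrix n n ℝ)).PosSemidef) (hB : (B - m • (1 : Matrix n n ℝ)).PosSemidef)
    (hθ : δ / (δ + m) ≤ θ) (hθ1 : θ ≤ 1) :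
    ((1 - θ) • A + θ • B).PosSemidef := by
  have hden : 0 < δ + m := by linarith
  have hθ0 : 0 ≤ θ := le_trans (div_nonneg hδ hden.le) hθ
  have hδθ : δ ≤ θ * (δ + m) := (div_le_iff₀ hden).mp hθ
  have hc : 0 ≤ θ * m - (1 - θ) * δ := by nlinarith
  have key : (1 - θ) • A + θ • B =
      (1 - θ) • (A + δ • (1 : Matrix n n ℝ)) + θ • (B - m • (1 : Matrix n n ℝ))
        + (θ * m - (1 - θ) * δ) • (1 : Matrix n n ℝ) := by
    ext i j
    simp only [Matrix.add_apply, Matrix.smul_apply, Matrix.sub_apply, Matrix.one_apply, smul_eq_mul]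
    split_ifs <;> ring
  rw [key]
  exact ((hA.smul (by linarith)).add (hB.smul hθ0)).add (Matrix.PosSemidef.one.smul hc)

/-- **L3 (y-form of Jansson–Chaykin–Keil Thm 4.1).** Any point satisfying the equality rows with PSD blocks
bounds the program value (the infimum over the feasible set) from above.  (`JanssonChaykinKeil.theorem_4_1`
is the X-form; this is the form the fleet's cone programs are written in.) -/
theorem lmiForm_upper {V E K : Type*} [Fintype V] [Fintype E] [Fintype K] {σ : K → Type*}
    [∀ k, Fintype (σ k)] [∀ k, DecidableEq (σ k)]
    (c : V → ℝ) (rowE : E → V → ℝ) (rhs : E → ℝ)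
    (Cb : ∀ k, Matrix (σ k) (σ k) ℝ) (F : ∀ k, V → Matrix (σ k) (σ k) ℝ)
    {y : V → ℝ} (heq : ∀ r, ∑ v, rowE r v * y v = rhs r)
    (hpsd : ∀ k, (Cb k + ∑ v, y v • F k v).PosSemidef)
    (hbdd : BddBelow {t : ℝ | ∃ y' : V → ℝ, (∀ r, ∑ v, rowE r v * y' v = rhs r) ∧
      (∀ k, (Cb k + ∑ v, y' v • F k v).PosSemidef) ∧ t = ∑ v, c v * y' v}) :
    sInf {t : ℝ | ∃ y' : V → ℝ, (∀ r, ∑ v, rowE r v * y' v = rhs r) ∧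
      (∀ k, (Cb k + ∑ v, y' v • F k v).PosSemidef) ∧ t = ∑ v, c v * y' v} ≤ ∑ v, c v * y v :=
  csInf_le hbdd ⟨y, heq, hpsd, rfl⟩

/-- **First lemma of the line (statement; composition of L2 blockwise + L3).**  For an LMI-form program,
an exactly row-feasible candidate `x̂` with block floors `−δ_k`, an exactly feasible anchor `y∞` with block
margins `m_k > 0`, and any `θ ∈ [0,1]` dominating every `δ_k/(δ_k+m_k)`, the mixed point certifies
`v*(P) ≤ (1−θ)·(c·x̂) + θ·(c·y∞)`. -/
def AnchorBracket : Prop :=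
  ∀ {V E K : Type} [Fintype V] [Fintype E] [Fintype K] {σ : K → Type}
    [∀ k, Fintype (σ k)] [∀ k, DecidableEq (σ k)]
    (c : V → ℝ) (rowE : E → V → ℝ) (rhs : E → ℝ)
    (Cb : ∀ k, Matrix (σ k) (σ k) ℝ) (F : ∀ k, V → Matrix (σ k) (σ k) ℝ)
    (xh yinf : V → ℝ) (δ m : K → ℝ) (θ : ℝ),
    (∀ r, ∑ v, rowE r v * xh v = rhs r) → (∀ r, ∑ v, rowE r v * yinf v = rhs r) →
    (∀ k, 0 ≤ δ k) → (∀ k, 0 < m k) →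
    (∀ k, (Cb k + ∑ v, xh v • F k v + δ k • (1 : Matrix (σ k) (σ k) ℝ)).PosSemidef) →
    (∀ k, (Cb k + ∑ v, yinf v • F k v - m k • (1 : Matrix (σ k) (σ k) ℝ)).PosSemidef) →
    (∀ k, δ k / (δ k + m k) ≤ θ) → θ ≤ 1 →
    BddBelow {t : ℝ | ∃ y' : V → ℝ, (∀ r, ∑ v, rowE r v * y' v = rhs r) ∧
      (∀ k, (Cb k + ∑ v, y' v • F k v).PosSemidef) ∧ t = ∑ v, c v * y' v} →
    sInf {t : ℝ | ∃ y' : V → ℝ, (∀ r, ∑ v, rowE r v * y' v = rhs r) ∧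
      (∀ k, (Cb k + ∑ v, y' v • F k v).PosSemidef) ∧ t = ∑ v, c v * y' v}
      ≤ (1 - θ) * (∑ v, c v * xh v) + θ * (∑ v, c v * yinf v)

/-- **L4 (EDITION SIEVE arithmetic).** Mixing once more absorbs a NEW block's violation: if `y_θ` is feasible
for `P` with value `U ≤ e∞`, the candidate family `W`'s block has violation `v ≥ 0` at (a completion of) `y_θ`
and anchor margin `m > 0`, then the second mix with any weight `θ' ≤ v/(v+m)` that restores the new block (L2 applied to the
new block only; `P`'s constraints are convex so they survive) is feasible for `P ⊕ W` and its value
`U + θ'(e∞ − U)` is at most `U + (v/m)(e∞ − U)`: a certified CEILING on the edition `P ⊕ W` computed without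
building or solving it. -/
theorem editionCeiling_arith {U e v m θ : ℝ} (hm : 0 < m) (hv : 0 ≤ v)
    (hθ : θ ≤ v / (v + m)) (hU : U ≤ e) :
    U + θ * (e - U) ≤ U + (v / m) * (e - U) := by
  have h1 : v / (v + m) ≤ v / m := by
    rw [div_le_div_iff₀ (by linarith) hm]
    nlinarith
  have h2 : θ ≤ v / m := hθ.trans h1
  nlinarith [mul_le_mul_of_nonneg_right h2 (sub_nonneg.mpr hU)]

/-- **`AnchorBracket` holds** (composition of L2 blockwise with L3; rows and objective are linear,
blocks affine, so the mixed point is feasible and its value is the stated convex combination). -/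
theorem anchorBracket_holds : AnchorBracket := by
  intro V E K _ _ _ σ _ _ c rowE rhs Cb F xh yinf δ m θ hx hy hδ hm hA hB hθ hθ1 hbdd
  have hrows : ∀ r, ∑ v, rowE r v * ((1 - θ) * xh v + θ * yinf v) = rhs r := by
    intro r
    have e1 : ∑ v, rowE r v * ((1 - θ) * xh v + θ * yinf v)
        = (1 - θ) * ∑ v, rowE r v * xh v + θ * ∑ v, rowE r v * yinf v := by
      rw [Finset.mul_sum, Finset.mul_sum, ← Finset.sum_add_distrib]
      refine Finset.sum_congr rfl ?_
      intro v _
      ring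
    rw [e1, hx r, hy r]
    ring
  have hblk : ∀ k, (Cb k + ∑ v, ((1 - θ) * xh v + θ * yinf v) • F k v).PosSemidef := by
    intro k
    have hid : Cb k + ∑ v, ((1 - θ) * xh v + θ * yinf v) • F k v
        = (1 - θ) • (Cb k + ∑ v, xh v • F k v) + θ • (Cb k + ∑ v, yinf v • F k v) := by
      ext i j
      simp only [Matrix.add_apply, Matrix.smul_apply, Matrix.sum_apply, smul_eq_mul]
      have e1 : ∑ v, ((1 - θ) * xh v + θ * yinf v) * F k v i j
          = (1 - θ) * ∑ v, xh v * F k v i j + θ * ∑ v, yinf v * F k v i j := by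
        rw [Finset.mul_sum, Finset.mul_sum, ← Finset.sum_add_distrib]
        refine Finset.sum_congr rfl ?_
        intro v _
        ring
      rw [e1]
      ring
    rw [hid]
    exact anchorMix_posSemidef (hδ k) (hm k) (hA k) (hB k) (hθ k) hθ1
  have key := lmiForm_upper c rowE rhs Cb F (y := fun v => (1 - θ) * xh v + θ * yinf v) hrows hblk hbdd
  have hobj : ∑ v, c v * ((1 - θ) * xh v + θ * yinf v)
      = (1 - θ) * ∑ v, c v * xh v + θ * ∑ v, c v * yinf v := by
    rw [Finset.mul_sum, Finset.mul_sum, ← Finset.sum_add_distrib]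
    refine Finset.sum_congr rfl ?_
    intro v _
    ring
  calc sInf {t : ℝ | ∃ y' : V → ℝ, (∀ r, ∑ v, rowE r v * y' v = rhs r) ∧
        (∀ k, (Cb k + ∑ v, y' v • F k v).PosSemidef) ∧ t = ∑ v, c v * y' v}
      ≤ ∑ v, c v * ((1 - θ) * xh v + θ * yinf v) := key
    _ = (1 - θ) * (∑ v, c v * xh v) + θ * (∑ v, c v * yinf v) := hobj

end Summit.Ventures.CertifiedManyBodySolver.Cruxes.LowerEdge_ge_m4o5.PrimalBracket
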